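import Summits.QuantumFields.YangMills.Theorems.BalabanUVNodesN11CondLawInFibreChart
import Summits.QuantumFields.YangMills.Theorems.BalabanUVNodesN11FirstStepSupply

/-!
# DAG node N11 — THE T-STEP (†) IN A FIBRE CHART: def-T's `transportOfRecord` ∕ `tstepOfRecord` ∕ the represented tower's pre-𝐑 slots, and the FIRST STEP
# (`FirstStepIntegralIdentityAt θ p`, level 0), in chart currency — every density, every new sequence at once

HEADER — WORK-UNIT METADATA.  Cell `pub-ymgap`, YM-PLAN Track A (HUMAN RULING D-0062), seat `pub-ymgap-dag-n08-w2` (g7; WIDTH SEAT 2∕4 on N08 [B10],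
RE-POINTED to N11's [III] §3-supply residue), route `BalabanUVNodes` rev 25, item K1⁷ `StabilityBAtRecordR13SepCoPH` = stmt-QuantumFields-20542 (helper lane,
`--kind proof --supports 20542 --as helper`, count-neutral).  [I] = [Balaban1987RG1], [III] = [Balaban1988Convergent], [IV] = [Balaban1989LargeFieldI],
[15] = [Balaban1985Variational].  FILE 2 of 2: the RECORD face of FILE 1 `…N11CondLawInFibreChart` (p611747 ✓: on a `V`-dependent charted window of the joint law,
`(margDensity V) • (condLaw V)|_{𝒮_V}` = the chart's fibre measure for `μ`-a.e. `V`; `kernelTransport` in the chart for EVERY density at once, ★★★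
`ae_forall_kernelTransport_eq_chart`).  Over node00-def-T's `Node00/TStepOfRecord` (`transportOfRecord`, `tstepOfRecord`, `tstepOfRecord_apply`), `Node00/RepTowerOfRecord` +
`TkNoExpansionStepSucc` (`slotsTOfRecord`, `slotsOfRecord`, `slotsTOfRecord_succ_apply`), `Node00/Record12ResidualsSlots` (`measurable_rhoZeroOfRecord`), and this seat's
`…N11FirstStepSupply` (p588912 ✓: `FirstStepIntegralIdentityAt`, `slotsTOfRecord₁₃H_one_apply ∕ _eq`, `sLaw₁₃CoPH_one_rePinH_doorCured_theta13LiveOfRecord_of_integralIdentity`).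

WHY THIS FILE.  def-T's value-level T-step (†), [III] (3.1) p. 264 read as the one-step disintegration transport along the averaging of record,
  `tstepOfRecord … k T s′ V′ = transportOfRecord k (U ↦ w(s′)(U,V′) · χ_k(init s′)(U) · T(init s′)(U)) V′`      (`tstepOfRecord_apply`; `slotsTOfRecord_succ_apply`)
is the LEFT side of N11's 𝐓-present child obligation (O3′) and, at `k = 0`, of the 𝐓-image clause (iii′) of this seat's `FirstStepIntegralIdentityAt θ p` ([I] Thm 1's first
step `𝐓ρ₀ = 𝐓₁ exp A₁` at the objects of record).  Its integrand depends on `V′` through the step weight, and the window of `U` on which (3.2)–(3.5) ∕ the chart of pp. 267–270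
live is `V′`-dependent — exactly the situation FILE 1's kernel-level socket is for.  HERE: given a fibre chart `(X, κ, Ψ, J)` of the joint law of `(Ū, U)` under
`dU = fieldMeasure k` on a measurable window `𝒮 ⊆ (coarse × fine)` (ONE hypothesis `hchart`, w.r.t. `dV′ = fieldMeasure (k+1)`) CARRYING THE STEP WEIGHTS' SUPPORT (displayed
`hw𝒮 : w(s′)(U,V′) = 0` off `𝒮`), for `dV′`-a.e. `V′`, SIMULTANEOUSLY for every density and every new sequence `s′`:
  `transportOfRecord k ρ V′ = ∫ J(V′,x)·ρ(Ψ(V′,x)) κ_{V′}(dx)` (every measurable `ρ` vanishing off `𝒮_{V′}`),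
  `tstepOfRecord … k T s′ V′ = ∫ J(V′,x) · w(s′)(Ψ(V′,x), V′) · χ_k(init s′)(Ψ(V′,x)) · T(init s′)(Ψ(V′,x)) κ_{V′}(dx)`, likewise the represented tower's `slotsT_{k+1}(s′)`;
and at level `0` (§5, Stage-13 letters): `slotsT₁(s)(V′) = ∫ J(V′,x) · w₀(s)(Ψ(V′,x), V′) · ρ₀(Ψ(V′,x)) κ_{V′}(dx)` for every length-1 history, whence
`FirstStepIntegralIdentityAt θ p ↔` the SAME predicate with clause (iii′) written as the CHART IDENTITY `∫ J w₀ ρ₀∘Ψ dκ_{V′} = 𝐓₁(s)[W(s)](exp A₁(s)[u s, E₁ s])(V′)` a.e. on the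
support of `χ₁(s)` — the first renormalization step «with the δ-functions removed» ([III] p. 267 L18–24), as a target a chart seat can read; `.mpr` followed by this seat's
`sLaw₁₃CoPH_one_rePinH_doorCured_theta13LiveOfRecord_of_integralIdentity` gives `ρ₁`'s §2 form at the re-pinned door of the cured witness of record from chart-level
first-step data and `0 < K` alone.

WHAT THIS FILE PROVES (0 `def`, 0 `sorry`, standard axioms).
§4 ★★ `ae_forall_transportOfRecord_eq_chart` · ★★ `ae_forall_tstepOfRecord_eq_chart` · ★★ `ae_forall_slotsTOfRecord_succ_eq_chart`.
§4b `kernelTransport_apply_family_ae_eq_graph` · `tstepOfRecord_ae_eq_transportOfRecord_graph` ((†) on the graph: the weights' `V′`-dependence is immaterial `dV′`-a.e.).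
§5 ★★ `ae_forall_slotsTOfRecord₁₃H_succ_eq_chart` · ★★ `tImageClause_iff_chart` (every level, Stage-13 letters; the (O3′) ∕ no-expansion clause shape with arbitrary right side)
   · ★★ `ae_forall_slotsTOfRecord₁₃H_one_eq_chart` · ★★★ `firstStepIntegralIdentityAt_iff_chart` (level 0).
§6 `chart_fst_prod` (anti-vacuity: FILE 1's hypothesis `hchart` holds for the identity chart of a product reference along `Prod.fst`).

HONEST FRAMING.  Helper lane of K1⁷; count-neutral; by-name instantiation of FILE 1 at def-T's objects — kernel bookkeeping; NO chart constructed, NO Jacobian computed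
(`hchart`, the weights' measurability `hw` and support `hw𝒮` are DISPLAYED hypotheses); `FirstStepIntegralIdentityAt θ p` is NOT proved for any `θ` (it IS [I] Thm 1 + [II] at
the level-1 objects of record); nothing of Bałaban ([I] §2, [III] §3 (3.10)–(3.25), [15] (47)–(49)) is asserted; (S-α) ∕ (B4) NOT closed; N11 NOT discharged; N08 untouched;
K1⁷ NOT closed; counts unmoved (typed 28∕28 · discharged 5∕27).  One finite `𝕋⁴_{L^K}` programme at fixed `ε = L^{−K}`; R4 closes only the conditional finite-𝕋⁴ rung
`BalabanLadder.UV` — NOT ℝ⁴, NOT OS, NOT a mass gap, NOT Clay.  No `sorry`, `axiom`, `def`, `instance`, `notation`.  Sources (SHAPE ∕ bookkeeping only): [I] (0.4) p.253,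
Thm 1 p.259, (0.24)–(0.27) p.257; [III] Thm 1 p.262, (2.18) p.257, (2.23) p.258, (3.1) p.264, (3.2)–(3.5) p.265, p.267 L18–24, (3.24)–(3.25) p.270, §3 p.279; [IV] (0.2)–(0.3) p.176.
-/

noncomputable section

open MeasureTheory ProbabilityTheory
open scoped ENNReal NNReal

namespace Summit.QuantumFields.YangMills.Theorems.BalabanUVNodesN11TStepInFibreChart

open Literature.MathematicalPhysics.QuantumFieldTheory.Balaban1983to89
open Literature.MathematicalPhysics.QuantumFieldTheory.Balaban1983to89.T4AveragingDisintegration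
open BalabanUVNodesN11CondLawInFibreChart

/-! ## §4  At the record: `transportOfRecord`, def-T's (†) `tstepOfRecord` for ALL new sequences at once, the represented tower's pre-𝐑 slots — in chart currency -/

section Record

open Node00 hiding SU
open T4Continuum

variable {F : T4Family} {N : ℕ} [NeZero N]
variable {X : Type*} [MeasurableSpace X]

/-- **★★ THE TRANSPORT OF RECORD IN A FIBRE CHART OF THE JOINT LAW ON A WINDOW, EVERY DENSITY AT ONCE**: for `k < K` (def-T's `HaarAC` by `avOfRecord_haarAC`), a chart
`(X, κ, Ψ, J)` of the joint law of `(Ū, U)` under `dU = fieldMeasure k` on the window `𝒮 ⊆ (coarse × fine)` with respect to `dV′ = fieldMeasure (k+1)`: for `dV′`-a.e. `V′`,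
for EVERY measurable density `ρ` vanishing off `𝒮_{V′}`, `transportOfRecord F N K k ρ V′ = ∫ J(V′,x)·ρ(Ψ(V′,x)) κ_{V′}(dx)`.
[cite: Balaban1988Convergent, (3.1) p.264, p.267 L18–24; Balaban1987RG1, (0.4) p.253] -/
theorem ae_forall_transportOfRecord_eq_chart {K k : ℕ} (hk : k < K)
    {κ : Kernel (GaugeField (F.P K) (k + 1) (SU N)) X} [IsSFiniteKernel κ]
    {Ψ : GaugeField (F.P K) (k + 1) (SU N) × X → GaugeField (F.P K) k (SU N)} {J : GaugeField (F.P K) (k + 1) (SU N) × X → ℝ≥0}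
    (hΨ : Measurable Ψ) (hJ : Measurable J) {𝒮 : Set (GaugeField (F.P K) (k + 1) (SU N) × GaugeField (F.P K) k (SU N))} (h𝒮 : MeasurableSet 𝒮)
    (hchart : (((fieldMeasure (F.P K) (k + 1) (SU N)) ⊗ₘ κ).withDensity (fun z => (J z : ℝ≥0∞))).map (fun z => (z.1, Ψ z)) =
      (jointLaw (fieldMeasure (F.P K) k (SU N)) (avOfRecord F N K k).avg).restrict 𝒮) :
    ∀ᵐ V' ∂(fieldMeasure (F.P K) (k + 1) (SU N)), ∀ ρ : Density (F.P K) k (SU N), Measurable ρ → (∀ U, (V', U) ∉ 𝒮 → ρ U = 0) →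
      transportOfRecord F N K k ρ V' = ∫ x, (J (V', x) : ℝ) * ρ (Ψ (V', x)) ∂(κ V') :=
  ae_forall_kernelTransport_eq_chart (avOfRecord_measurable F N K k) (avOfRecord_haarAC F N K k hk) hΨ hJ h𝒮 hchart

/-- **★★ def-T's VALUE-LEVEL T-STEP (†) IN THE CHART, FOR ALL NEW SEQUENCES AT ONCE**: at a chart of the joint law on a window CARRYING THE STEP WEIGHTS' SUPPORT
(`hw𝒮 : w(s′)(U,V′) = 0` off `𝒮` — the resummed restrictions (3.2)–(3.3)∕(3.5) attached to the new pair), for `dV′`-a.e. `V′` and EVERY new sequence `s′`: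
`tstepOfRecord … k T s′ V′ = ∫ J(V′,x) · w(s′)(Ψ(V′,x), V′) · χ_k(init s′)(Ψ(V′,x)) · T(init s′)(Ψ(V′,x)) κ_{V′}(dx)` — [III] (3.1) at the new pair, with the δ-functions
removed in the chart.  The `V′`-dependence of the integrand is harmless because §3 is uniform in the density. [cite: Balaban1988Convergent, (3.1) p.264, (3.2)–(3.5) p.265, p.267 L18–24, (3.24)–(3.25) p.270] -/
theorem ae_forall_tstepOfRecord_eq_chart (ν : Stage7Numerics) (M : ℕ) (w : StepWeightsOfRecord F N ν M) (p : B12.RunParams) (g : ℕ → ℝ) {k : ℕ}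
    (hk : k < p.K) (T : SeqOfRecord F ν M g p.K k → Density (F.P p.K) k (SU N))
    {κ : Kernel (GaugeField (F.P p.K) (k + 1) (SU N)) X} [IsSFiniteKernel κ]
    {Ψ : GaugeField (F.P p.K) (k + 1) (SU N) × X → GaugeField (F.P p.K) k (SU N)} {J : GaugeField (F.P p.K) (k + 1) (SU N) × X → ℝ≥0}
    (hΨ : Measurable Ψ) (hJ : Measurable J) {𝒮 : Set (GaugeField (F.P p.K) (k + 1) (SU N) × GaugeField (F.P p.K) k (SU N))}
    (h𝒮 : MeasurableSet 𝒮)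
    (hchart : (((fieldMeasure (F.P p.K) (k + 1) (SU N)) ⊗ₘ κ).withDensity (fun z => (J z : ℝ≥0∞))).map (fun z => (z.1, Ψ z)) =
      (jointLaw (fieldMeasure (F.P p.K) k (SU N)) (avOfRecord F N p.K k).avg).restrict 𝒮)
    (hw : ∀ s' V', Measurable fun U => w p g k s' U V') (hχ : ∀ s, Measurable (chiSeqOfRecord F N ν M g p.K k s))
    (hT : ∀ s, Measurable (T s)) (hw𝒮 : ∀ s' U V', (V', U) ∉ 𝒮 → w p g k s' U V' = 0) :
    ∀ᵐ V' ∂(fieldMeasure (F.P p.K) (k + 1) (SU N)), ∀ s' : SeqOfRecord F ν M g p.K (k + 1),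
      tstepOfRecord F N ν M w p g k T s' V' =
        ∫ x, (J (V', x) : ℝ) * (w p g k s' (Ψ (V', x)) V' *
          (chiSeqOfRecord F N ν M g p.K k s'.init (Ψ (V', x)) * T s'.init (Ψ (V', x)))) ∂(κ V') := by
  filter_upwards [ae_forall_transportOfRecord_eq_chart (F := F) (N := N) hk hΨ hJ h𝒮 hchart] with V' hV' s'
  rw [tstepOfRecord_apply]
  exact hV' _ ((hw s' V').mul ((hχ _).mul (hT _))) fun U hU => by rw [hw𝒮 s' U V' hU, zero_mul]

/-- **★★ THE REPRESENTED TOWER'S PRE-𝐑 SLOTS AT LEVEL k+1 IN THE CHART, ALL NEW SEQUENCES AT ONCE** (def-T's (†) via `slotsTOfRecord_succ_apply`; the LEFT side of N11's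
𝐓-present child obligation (O3′) in chart currency): at a chart of the joint law on a window carrying the step weights' support, for `dV′`-a.e. `V′` and every `s′`,
`slotsT_{k+1}(s′)(V′) = ∫ J(V′,x) · w(s′)(Ψ(V′,x), V′) · χ_k(init s′)(Ψ(V′,x)) · slot_k(init s′)(Ψ(V′,x)) κ_{V′}(dx)`.
[cite: Balaban1988Convergent, (3.1) p.264, (3.2)–(3.5) p.265, p.267 L18–24, (3.24)–(3.25) p.270; Balaban1989LargeFieldI, (0.2)–(0.3) p.176] -/
theorem ae_forall_slotsTOfRecord_succ_eq_chart (ν : Stage7Numerics) (τ : TowerNumerics) (E : B12.RunParams → ℝ) (w : StepWeightsOfRecord F N ν τ.M)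
    (ppSel : PpSelOfRecord F ν τ.M) (p : B12.RunParams) (g : ℕ → ℝ) {k : ℕ} (hk : k < p.K)
    {κ : Kernel (GaugeField (F.P p.K) (k + 1) (SU N)) X} [IsSFiniteKernel κ]
    {Ψ : GaugeField (F.P p.K) (k + 1) (SU N) × X → GaugeField (F.P p.K) k (SU N)} {J : GaugeField (F.P p.K) (k + 1) (SU N) × X → ℝ≥0}
    (hΨ : Measurable Ψ) (hJ : Measurable J) {𝒮 : Set (GaugeField (F.P p.K) (k + 1) (SU N) × GaugeField (F.P p.K) k (SU N))}
    (h𝒮 : MeasurableSet 𝒮)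
    (hchart : (((fieldMeasure (F.P p.K) (k + 1) (SU N)) ⊗ₘ κ).withDensity (fun z => (J z : ℝ≥0∞))).map (fun z => (z.1, Ψ z)) =
      (jointLaw (fieldMeasure (F.P p.K) k (SU N)) (avOfRecord F N p.K k).avg).restrict 𝒮)
    (hw : ∀ s' V', Measurable fun U => w p g k s' U V') (hχ : ∀ s, Measurable (chiSeqOfRecord F N ν τ.M g p.K k s))
    (hslot : ∀ s, Measurable (slotsOfRecord F N ν τ E w ppSel p g k s)) (hw𝒮 : ∀ s' U V', (V', U) ∉ 𝒮 → w p g k s' U V' = 0) :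
    ∀ᵐ V' ∂(fieldMeasure (F.P p.K) (k + 1) (SU N)), ∀ s' : SeqOfRecord F ν τ.M g p.K (k + 1),
      slotsTOfRecord F N ν τ E w ppSel p g (k + 1) s' V' =
        ∫ x, (J (V', x) : ℝ) * (w p g k s' (Ψ (V', x)) V' *
          (chiSeqOfRecord F N ν τ.M g p.K k s'.init (Ψ (V', x)) * slotsOfRecord F N ν τ E w ppSel p g k s'.init (Ψ (V', x)))) ∂(κ V') := by
  filter_upwards [ae_forall_transportOfRecord_eq_chart (F := F) (N := N) hk hΨ hJ h𝒮 hchart] with V' hV' s'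
  rw [slotsTOfRecord_succ_apply]
  exact hV' _ ((hw s' V').mul ((hχ _).mul (hslot _))) fun U hU => by rw [hw𝒮 s' U V' hU, zero_mul]

end Record

/-! ## §4b  (†) ON THE GRAPH: the `V′`-dependence of the step weights is immaterial `dV′`-a.e. (`w(s′)(U,V′) = w(s′)(U,Ū)` on the fibre) -/

section Graph

variable {α β : Type*} [MeasurableSpace α] [MeasurableSpace β] [StandardBorelSpace β] [Nonempty β] [MeasurableEq α]
variable {ν : Measure β} [IsFiniteMeasure ν] {μ : Measure α} [SigmaFinite μ] {avg : β → α}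

/-- **A `V`-DEPENDENT FAMILY OF DENSITIES IS TRANSPORTED AS ITS GRAPH RESTRICTION, `μ`-a.e.**: for ANY family `f : α → β → ℝ` (no measurability asked),
`kernelTransport ν μ avg (f V) V = kernelTransport ν μ avg (U ↦ f (Ū) U) V` for `μ`-a.e. `V` — the conditional law lives on the fibre `{Ū = V}` wherever the marginal density
does not vanish (def-T's `condLaw_fibre_ae`, `withDensity_margDensity`).  So a PER-DENSITY identity (dag-n11-d's p610288 ★★★, fixed charted set) also reaches def-T's (†), one
new sequence at a time, through the FIXED density `U ↦ w(s′)(U,Ū)·χ_k·T`; what it cannot absorb is a `V′`-DEPENDENT charted WINDOW — that is FILE 1's kernel-level socket.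
[cite: Balaban1987RG1, (0.4) p.253 (the δ-function `δ(ŪV⁻¹)`); Balaban1988Convergent, (3.1) p.264 (bookkeeping)] -/
theorem kernelTransport_apply_family_ae_eq_graph (havg : Measurable avg) (hac : ν.map avg ≪ μ) (f : α → β → ℝ) :
    (fun V => kernelTransport ν μ avg (f V) V) =ᵐ[μ] fun V => kernelTransport ν μ avg (fun U => f (avg U) U) V := by
  have h1 : ∀ᵐ V ∂(ν.map avg), condLaw ν avg V {U | avg U = V} = 1 := condLaw_fibre_ae ν havg
  rw [← withDensity_margDensity ν μ havg hac, ae_withDensity_iff measurable_margDensity.coe_nnreal_ennreal] at h1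
  filter_upwards [h1] with V hV
  unfold kernelTransport
  by_cases hz : margDensity ν μ avg V = 0
  · simp only [hz, NNReal.coe_zero, zero_mul]
  · have hfib : ∀ᵐ U ∂(condLaw ν avg V), avg U = V :=
      mem_ae_iff.2 ((prob_compl_eq_zero_iff (measurableSet_eq_fun havg measurable_const)).2 (hV (by exact_mod_cast hz)))
    congr 1
    refine integral_congr_ae ?_
    filter_upwards [hfib] with U hU
    rw [hU]

end Graph

section GraphRecord

open Node00 hiding SU
open T4Continuum

variable {F : T4Family} {N : ℕ} [NeZero N]

/-- **def-T's (†) IS THE TRANSPORT OF THE GRAPH-RESTRICTED INTEGRAND, `dV′`-a.e.**: for every new sequence `s′` and `k < K`,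
`tstepOfRecord … k T s′ =ᵐ[dV′] transportOfRecord k (U ↦ w(s′)(U, Ū) · χ_k(init s′)(U) · T(init s′)(U))` — a FIXED density (no `V′` inside), to which any per-density transport
identity applies. [cite: Balaban1988Convergent, (3.1) p.264, (3.2)–(3.5) p.265 (bookkeeping)] -/
theorem tstepOfRecord_ae_eq_transportOfRecord_graph (ν : Stage7Numerics) (M : ℕ) (w : StepWeightsOfRecord F N ν M) (p : B12.RunParams) (g : ℕ → ℝ) {k : ℕ}
    (hk : k < p.K) (T : SeqOfRecord F ν M g p.K k → Density (F.P p.K) k (SU N)) (s' : SeqOfRecord F ν M g p.K (k + 1)) :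
    tstepOfRecord F N ν M w p g k T s' =ᵐ[fieldMeasure (F.P p.K) (k + 1) (SU N)]
      transportOfRecord F N p.K k (fun U => w p g k s' U ((avOfRecord F N p.K k).avg U) *
        (chiSeqOfRecord F N ν M g p.K k s'.init U * T s'.init U)) := by
  filter_upwards [kernelTransport_apply_family_ae_eq_graph (avOfRecord_measurable F N p.K k) (avOfRecord_haarAC F N p.K k hk)
    (f := fun V' U => w p g k s' U V' * (chiSeqOfRecord F N ν M g p.K k s'.init U * T s'.init U))] with V' hV'
  rw [tstepOfRecord_apply]
  exact hV'

end GraphRecord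

/-! ## §5  In the Stage-13 letters: the pre-𝐑 slots and the 𝐓-image clause at every level; at level `0` the slots of `𝐓ρ₀` and the FIRST STEP `FirstStepIntegralIdentityAt θ p` -/

section FirstStep

open scoped Matrix.Norms.L2Operator
open Node00 hiding SU
open T4Continuum Node00.Tk Step
open BalabanUVNodesN11FirstStepSupply

variable {F : T4Family} {N : ℕ} [NeZero N]
variable {X : Type*} [MeasurableSpace X]

/-- **★★ THE PRE-𝐑 SLOTS OF RECORD AT LEVEL k+1 IN THE CHART, STAGE-13 LETTERS, EVERY HISTORY AT ONCE**: at a v1.7 parameter `θ`, `k < K`, given a fibre chart of the joint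
law of `(Ū, U)` under `dU = fieldMeasure k` on a window `𝒮` carrying the level-`k` step weights' support (`hw𝒮`; measurable `U`-sections `hw`, measurable `χ_k(s₀)` and
`slot_k(s₀)` — `hχ`, `hslot`), for `dV′`-a.e. `V′` and every length-(k+1) history `s`:
`slotsT_{k+1}(s)(V′) = ∫ J(V′,x) · w_k(s)(Ψ(V′,x), V′) · χ_k(init s)(Ψ(V′,x)) · slot_k(init s)(Ψ(V′,x)) κ_{V′}(dx)` — §4 at def-K0a's objects of record (`θ.ν, θ.τ9,
EOfRecord₁₃, wOfRecord₉, θ.ppSel, gOfRecord₁₃`). [cite: Balaban1988Convergent, (3.1) p.264, (3.2)–(3.5) p.265, p.267 L18–24, (3.24)–(3.25) p.270; Balaban1989LargeFieldI, (0.2)–(0.3) p.176] -/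
theorem ae_forall_slotsTOfRecord₁₃H_succ_eq_chart (θ : Stage13HParams F N) (p : B12.RunParams) {k : ℕ} (hk : k < p.K)
    {κ : Kernel (GaugeField (F.P p.K) (k + 1) (SU N)) X} [IsSFiniteKernel κ]
    {Ψ : GaugeField (F.P p.K) (k + 1) (SU N) × X → GaugeField (F.P p.K) k (SU N)} {J : GaugeField (F.P p.K) (k + 1) (SU N) × X → ℝ≥0}
    (hΨ : Measurable Ψ) (hJ : Measurable J) {𝒮 : Set (GaugeField (F.P p.K) (k + 1) (SU N) × GaugeField (F.P p.K) k (SU N))} (h𝒮 : MeasurableSet 𝒮)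
    (hchart : (((fieldMeasure (F.P p.K) (k + 1) (SU N)) ⊗ₘ κ).withDensity (fun z => (J z : ℝ≥0∞))).map (fun z => (z.1, Ψ z)) =
      (jointLaw (fieldMeasure (F.P p.K) k (SU N)) (avOfRecord F N p.K k).avg).restrict 𝒮)
    (hw : ∀ (s : SeqOfRecord F θ.ν θ.τ9.M (gOfRecord₁₃ F N θ.toStage13Params p) p.K (k + 1)) (V' : GaugeField (F.P p.K) (k + 1) (SU N)),
      Measurable fun U => wOfRecord₉ F N θ.toStage9Params p (gOfRecord₁₃ F N θ.toStage13Params p) k s U V')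
    (hχ : ∀ s₀ : SeqOfRecord F θ.ν θ.τ9.M (gOfRecord₁₃ F N θ.toStage13Params p) p.K k,
      Measurable (chiSeqOfRecord F N θ.ν θ.τ9.M (gOfRecord₁₃ F N θ.toStage13Params p) p.K k s₀))
    (hslot : ∀ s₀ : SeqOfRecord F θ.ν θ.τ9.M (gOfRecord₁₃ F N θ.toStage13Params p) p.K k,
      Measurable (slotsOfRecord F N θ.ν θ.τ9 (EOfRecord₁₃ F N θ.toStage13Params) (wOfRecord₉ F N θ.toStage9Params) θ.ppSel p (gOfRecord₁₃ F N θ.toStage13Params p) k s₀))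
    (hw𝒮 : ∀ (s : SeqOfRecord F θ.ν θ.τ9.M (gOfRecord₁₃ F N θ.toStage13Params p) p.K (k + 1)) (U : GaugeField (F.P p.K) k (SU N))
      (V' : GaugeField (F.P p.K) (k + 1) (SU N)), (V', U) ∉ 𝒮 → wOfRecord₉ F N θ.toStage9Params p (gOfRecord₁₃ F N θ.toStage13Params p) k s U V' = 0) :
    ∀ᵐ V' ∂(fieldMeasure (F.P p.K) (k + 1) (SU N)), ∀ s : SeqOfRecord F θ.ν θ.τ9.M (gOfRecord₁₃ F N θ.toStage13Params p) p.K (k + 1),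
      slotsTOfRecord F N θ.ν θ.τ9 (EOfRecord₁₃ F N θ.toStage13Params) (wOfRecord₉ F N θ.toStage9Params) θ.ppSel p (gOfRecord₁₃ F N θ.toStage13Params p) (k + 1) s V' =
        ∫ x, (J (V', x) : ℝ) * (wOfRecord₉ F N θ.toStage9Params p (gOfRecord₁₃ F N θ.toStage13Params p) k s (Ψ (V', x)) V' *
          (chiSeqOfRecord F N θ.ν θ.τ9.M (gOfRecord₁₃ F N θ.toStage13Params p) p.K k s.init (Ψ (V', x)) *
            slotsOfRecord F N θ.ν θ.τ9 (EOfRecord₁₃ F N θ.toStage13Params) (wOfRecord₉ F N θ.toStage9Params) θ.ppSel p (gOfRecord₁₃ F N θ.toStage13Params p) k s.init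
              (Ψ (V', x)))) ∂(κ V') :=
  ae_forall_slotsTOfRecord_succ_eq_chart θ.ν θ.τ9 (EOfRecord₁₃ F N θ.toStage13Params) (wOfRecord₉ F N θ.toStage9Params) θ.ppSel p
    (gOfRecord₁₃ F N θ.toStage13Params p) hk hΨ hJ h𝒮 hchart hw hχ hslot hw𝒮

/-- **★★ THE 𝐓-IMAGE CLAUSE IN CHART CURRENCY, EVERY LEVEL** (the shape of dag-n11-e's (O3′) in `PresentChildObligations` and of `NoExpansionClauseFor`, with an ARBITRARY
right side `R`): under the same level-`k` chart data, for every length-(k+1) history `s`,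
`(slotsT_{k+1}(s) ≡ 0 ∨ a.e. on supp χ_{k+1}(s): slotsT_{k+1}(s)(V′) = R V′) ↔ (slotsT_{k+1}(s) ≡ 0 ∨ a.e. on supp χ_{k+1}(s): ∫ J·w_k(s)(Ψ,V′)·χ_k(init s)∘Ψ·slot_k(init s)∘Ψ dκ_{V′} = R V′)`
— [III] (3.24)–(3.25)'s slot identity «with the δ-functions removed» (p. 267), as a target the chart ∕ [III] §3 seats can read. [cite: Balaban1988Convergent, (3.1) p.264, p.267 L18–24, (3.24)–(3.25) p.270, §3 p.279, Thm 2 p.263] -/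
theorem tImageClause_iff_chart (θ : Stage13HParams F N) (p : B12.RunParams) {k : ℕ} (hk : k < p.K)
    {κ : Kernel (GaugeField (F.P p.K) (k + 1) (SU N)) X} [IsSFiniteKernel κ]
    {Ψ : GaugeField (F.P p.K) (k + 1) (SU N) × X → GaugeField (F.P p.K) k (SU N)} {J : GaugeField (F.P p.K) (k + 1) (SU N) × X → ℝ≥0}
    (hΨ : Measurable Ψ) (hJ : Measurable J) {𝒮 : Set (GaugeField (F.P p.K) (k + 1) (SU N) × GaugeField (F.P p.K) k (SU N))} (h𝒮 : MeasurableSet 𝒮)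
    (hchart : (((fieldMeasure (F.P p.K) (k + 1) (SU N)) ⊗ₘ κ).withDensity (fun z => (J z : ℝ≥0∞))).map (fun z => (z.1, Ψ z)) =
      (jointLaw (fieldMeasure (F.P p.K) k (SU N)) (avOfRecord F N p.K k).avg).restrict 𝒮)
    (hw : ∀ (s : SeqOfRecord F θ.ν θ.τ9.M (gOfRecord₁₃ F N θ.toStage13Params p) p.K (k + 1)) (V' : GaugeField (F.P p.K) (k + 1) (SU N)),
      Measurable fun U => wOfRecord₉ F N θ.toStage9Params p (gOfRecord₁₃ F N θ.toStage13Params p) k s U V')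
    (hχ : ∀ s₀ : SeqOfRecord F θ.ν θ.τ9.M (gOfRecord₁₃ F N θ.toStage13Params p) p.K k,
      Measurable (chiSeqOfRecord F N θ.ν θ.τ9.M (gOfRecord₁₃ F N θ.toStage13Params p) p.K k s₀))
    (hslot : ∀ s₀ : SeqOfRecord F θ.ν θ.τ9.M (gOfRecord₁₃ F N θ.toStage13Params p) p.K k,
      Measurable (slotsOfRecord F N θ.ν θ.τ9 (EOfRecord₁₃ F N θ.toStage13Params) (wOfRecord₉ F N θ.toStage9Params) θ.ppSel p (gOfRecord₁₃ F N θ.toStage13Params p) k s₀))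
    (hw𝒮 : ∀ (s : SeqOfRecord F θ.ν θ.τ9.M (gOfRecord₁₃ F N θ.toStage13Params p) p.K (k + 1)) (U : GaugeField (F.P p.K) k (SU N))
      (V' : GaugeField (F.P p.K) (k + 1) (SU N)), (V', U) ∉ 𝒮 → wOfRecord₉ F N θ.toStage9Params p (gOfRecord₁₃ F N θ.toStage13Params p) k s U V' = 0)
    (s : SeqOfRecord F θ.ν θ.τ9.M (gOfRecord₁₃ F N θ.toStage13Params p) p.K (k + 1)) (R : GaugeField (F.P p.K) (k + 1) (SU N) → ℝ) :
    (slotsTOfRecord F N θ.ν θ.τ9 (EOfRecord₁₃ F N θ.toStage13Params) (wOfRecord₉ F N θ.toStage9Params) θ.ppSel p (gOfRecord₁₃ F N θ.toStage13Params p) (k + 1) s = 0 ∨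
      ∀ᵐ V' ∂fieldMeasure (F.P p.K) (k + 1) (SU N),
        chiSeqOfRecord F N θ.ν θ.τ9.M (gOfRecord₁₃ F N θ.toStage13Params p) p.K (k + 1) s V' ≠ 0 →
          slotsTOfRecord F N θ.ν θ.τ9 (EOfRecord₁₃ F N θ.toStage13Params) (wOfRecord₉ F N θ.toStage9Params) θ.ppSel p (gOfRecord₁₃ F N θ.toStage13Params p) (k + 1) s V' =
            R V') ↔
    (slotsTOfRecord F N θ.ν θ.τ9 (EOfRecord₁₃ F N θ.toStage13Params) (wOfRecord₉ F N θ.toStage9Params) θ.ppSel p (gOfRecord₁₃ F N θ.toStage13Params p) (k + 1) s = 0 ∨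
      ∀ᵐ V' ∂fieldMeasure (F.P p.K) (k + 1) (SU N),
        chiSeqOfRecord F N θ.ν θ.τ9.M (gOfRecord₁₃ F N θ.toStage13Params p) p.K (k + 1) s V' ≠ 0 →
          ∫ x, (J (V', x) : ℝ) * (wOfRecord₉ F N θ.toStage9Params p (gOfRecord₁₃ F N θ.toStage13Params p) k s (Ψ (V', x)) V' *
            (chiSeqOfRecord F N θ.ν θ.τ9.M (gOfRecord₁₃ F N θ.toStage13Params p) p.K k s.init (Ψ (V', x)) *
              slotsOfRecord F N θ.ν θ.τ9 (EOfRecord₁₃ F N θ.toStage13Params) (wOfRecord₉ F N θ.toStage9Params) θ.ppSel p (gOfRecord₁₃ F N θ.toStage13Params p) k s.init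
                (Ψ (V', x)))) ∂(κ V') = R V') := by
  refine or_congr_right (Filter.eventually_congr ?_)
  filter_upwards [ae_forall_slotsTOfRecord₁₃H_succ_eq_chart θ p hk hΨ hJ h𝒮 hchart hw hχ hslot hw𝒮] with V' hV'
  rw [hV' s]

/-- **★★ THE PRE-𝐑 SLOTS OF `𝐓ρ₀` IN THE CHART, EVERY LENGTH-1 HISTORY AT ONCE**: at a v1.7 parameter `θ`, `0 < K`, given a fibre chart `(X, κ, Ψ, J)` of the joint law of
`(Ū, U)` under `dU = fieldMeasure 0` on a window `𝒮` carrying the level-0 step weights' support (`hw𝒮`; measurable `U`-sections `hw`), for `dV′`-a.e. `V′` and every `s`: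
`slotsT₁(s)(V′) = ∫ J(V′,x) · w₀(s)(Ψ(V′,x), V′) · ρ₀(Ψ(V′,x)) κ_{V′}(dx)` (`χ₀ ≡ 1`, `slot₀ = ρ₀ = e^{−E(p)}·exp[−(1∕g₀²)A]`; this seat's `slotsTOfRecord₁₃H_one_apply` + §4).
[cite: Balaban1988Convergent, Thm 1 p.262, (3.1) p.264, (3.2)–(3.5) p.265, p.267 L18–24, (3.24)–(3.25) p.270] -/
theorem ae_forall_slotsTOfRecord₁₃H_one_eq_chart (θ : Stage13HParams F N) (p : B12.RunParams) (hK : 0 < p.K)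
    {κ : Kernel (GaugeField (F.P p.K) 1 (SU N)) X} [IsSFiniteKernel κ]
    {Ψ : GaugeField (F.P p.K) 1 (SU N) × X → GaugeField (F.P p.K) 0 (SU N)} {J : GaugeField (F.P p.K) 1 (SU N) × X → ℝ≥0}
    (hΨ : Measurable Ψ) (hJ : Measurable J) {𝒮 : Set (GaugeField (F.P p.K) 1 (SU N) × GaugeField (F.P p.K) 0 (SU N))} (h𝒮 : MeasurableSet 𝒮)
    (hchart : (((fieldMeasure (F.P p.K) 1 (SU N)) ⊗ₘ κ).withDensity (fun z => (J z : ℝ≥0∞))).map (fun z => (z.1, Ψ z)) =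
      (jointLaw (fieldMeasure (F.P p.K) 0 (SU N)) (avOfRecord F N p.K 0).avg).restrict 𝒮)
    (hw : ∀ (s : SeqOfRecord F θ.ν θ.τ9.M (gOfRecord₁₃ F N θ.toStage13Params p) p.K 1) (V' : GaugeField (F.P p.K) 1 (SU N)),
      Measurable fun U => wOfRecord₉ F N θ.toStage9Params p (gOfRecord₁₃ F N θ.toStage13Params p) 0 s U V')
    (hw𝒮 : ∀ (s : SeqOfRecord F θ.ν θ.τ9.M (gOfRecord₁₃ F N θ.toStage13Params p) p.K 1) (U : GaugeField (F.P p.K) 0 (SU N)) (V' : GaugeField (F.P p.K) 1 (SU N)),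
      (V', U) ∉ 𝒮 → wOfRecord₉ F N θ.toStage9Params p (gOfRecord₁₃ F N θ.toStage13Params p) 0 s U V' = 0) :
    ∀ᵐ V' ∂(fieldMeasure (F.P p.K) 1 (SU N)), ∀ s : SeqOfRecord F θ.ν θ.τ9.M (gOfRecord₁₃ F N θ.toStage13Params p) p.K 1,
      slotsTOfRecord F N θ.ν θ.τ9 (EOfRecord₁₃ F N θ.toStage13Params) (wOfRecord₉ F N θ.toStage9Params) θ.ppSel p (gOfRecord₁₃ F N θ.toStage13Params p) 1 s V' =
        ∫ x, (J (V', x) : ℝ) * (wOfRecord₉ F N θ.toStage9Params p (gOfRecord₁₃ F N θ.toStage13Params p) 0 s (Ψ (V', x)) V' *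
          rhoZeroOfRecord F N p.K (gOfRecord₁₃ F N θ.toStage13Params p 0) (EOfRecord₁₃ F N θ.toStage13Params p) (Ψ (V', x))) ∂(κ V') := by
  filter_upwards [ae_forall_transportOfRecord_eq_chart (F := F) (N := N) (k := 0) hK hΨ hJ h𝒮 hchart] with V' hV' s
  rw [slotsTOfRecord₁₃H_one_apply]
  exact hV' _ ((hw s V').mul (measurable_rhoZeroOfRecord F N p.K _ _)) fun U hU => by rw [hw𝒮 s U V' hU, zero_mul]

/-- **★★★ THE FIRST RENORMALIZATION STEP IN CHART CURRENCY**: under the same level-0 chart data, this seat's `FirstStepIntegralIdentityAt θ p` (`↔ FirstStepSupplyAt θ p ↔`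
dag-n11-e's `Sect3SpliceSupplyAt θ p 0`, p588912) is EQUIVALENT to the same predicate with the 𝐓-image clause (iii′) written «with the δ-functions removed»: for first-step term
values `u s` (universal in `𝐄^{(1)}`) and constants `E₁ s`, at every expansion pair `s = (Ω₁ ≠ ∅, Λ₁)`: (i) r11's new-term obligations, (ii) analyticity at level 1, and (iii″)
EITHER the slot `slotsT₁(s)` is the zero function, OR for `dV′`-a.e. `V′` on the support of `χ₁(s)`
  `∫ J(V′,x) · w₀(s)(Ψ(V′,x), V′) · ρ₀(Ψ(V′,x)) κ_{V′}(dx) = 𝐓₁(s)[W(s)] (exp A₁(s)[u s, E₁ s]) (V′)`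
— [I] Thm 1's first step `𝐓ρ₀ = 𝐓₁ exp A₁` as an identity between a chart integral and 11a's explicit operator at the background of record.  `.mpr` followed by this seat's
`sLaw₁₃CoPH_one_rePinH_doorCured_theta13LiveOfRecord_of_integralIdentity` gives `ρ₁`'s §2 form at the re-pinned door of the cured witness of record.  A predicate-level
equivalence — NOT claimed inhabited for any `θ`. [cite: Balaban1987RG1, Thm 1 p.259, (0.24)–(0.27) p.257; Balaban1988Convergent, Thm 1 p.262, (3.1) p.264, (3.24)–(3.25) p.270, (2.18) p.257, (2.23) p.258, §3 p.279, p.267 L18–24] -/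
theorem firstStepIntegralIdentityAt_iff_chart (θ : Stage13HParams F N) (p : B12.RunParams) (hK : 0 < p.K)
    {κ : Kernel (GaugeField (F.P p.K) 1 (SU N)) X} [IsSFiniteKernel κ]
    {Ψ : GaugeField (F.P p.K) 1 (SU N) × X → GaugeField (F.P p.K) 0 (SU N)} {J : GaugeField (F.P p.K) 1 (SU N) × X → ℝ≥0}
    (hΨ : Measurable Ψ) (hJ : Measurable J) {𝒮 : Set (GaugeField (F.P p.K) 1 (SU N) × GaugeField (F.P p.K) 0 (SU N))} (h𝒮 : MeasurableSet 𝒮)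
    (hchart : (((fieldMeasure (F.P p.K) 1 (SU N)) ⊗ₘ κ).withDensity (fun z => (J z : ℝ≥0∞))).map (fun z => (z.1, Ψ z)) =
      (jointLaw (fieldMeasure (F.P p.K) 0 (SU N)) (avOfRecord F N p.K 0).avg).restrict 𝒮)
    (hw : ∀ (s : SeqOfRecord F θ.ν θ.τ9.M (gOfRecord₁₃ F N θ.toStage13Params p) p.K 1) (V' : GaugeField (F.P p.K) 1 (SU N)),
      Measurable fun U => wOfRecord₉ F N θ.toStage9Params p (gOfRecord₁₃ F N θ.toStage13Params p) 0 s U V')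
    (hw𝒮 : ∀ (s : SeqOfRecord F θ.ν θ.τ9.M (gOfRecord₁₃ F N θ.toStage13Params p) p.K 1) (U : GaugeField (F.P p.K) 0 (SU N)) (V' : GaugeField (F.P p.K) 1 (SU N)),
      (V', U) ∉ 𝒮 → wOfRecord₉ F N θ.toStage9Params p (gOfRecord₁₃ F N θ.toStage13Params p) 0 s U V' = 0) :
    FirstStepIntegralIdentityAt θ p ↔
    ∃ (u : SeqOfRecord F θ.ν θ.τ9.M (gOfRecord₁₃ F N θ.toStage13Params p) p.K 1 → Sect2.TermValues (F.P p.K) (MatA N) (FluctV N) θ.τ9.M)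
      (E₁ : SeqOfRecord F θ.ν θ.τ9.M (gOfRecord₁₃ F N θ.toStage13Params p) p.K 1 → ℝ),
      Sect2.UniversalE u ∧
      ∀ s : SeqOfRecord F θ.ν θ.τ9.M (gOfRecord₁₃ F N θ.toStage13Params p) p.K 1, s.Ω 1 ≠ ∅ →
        Step.LFNewTerms (sect2TowerOfRecord F N (FluctV N) p.K (settingOfRecord₁₃ F N θ.toStage13Params p) (θ.rzAt p s) s (u s))
          (settingOfRecord₁₃ F N θ.toStage13Params p).lf (settingOfRecord₁₃ F N θ.toStage13Params p).βc 0 ∧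
        (∀ (X : (Sect2.domSys (F.P p.K) θ.τ9.M 1).Dom) (z : Site (F.P p.K) 1) (g : ℝ), 0 ≤ g → g ≤ (settingOfRecord₁₃ F N θ.toStage13Params p).lf.γ →
          AnalyticOnNhd ℂ ((u s).E 1 X z g)
            ((sect2TowerOfRecord F N (FluctV N) p.K (settingOfRecord₁₃ F N θ.toStage13Params p) (θ.rzAt p s) s (u s)).space 1 X
              ((settingOfRecord₁₃ F N θ.toStage13Params p).lf.alpha0 ((settingOfRecord₁₃ F N θ.toStage13Params p).flow.g 1))
              ((settingOfRecord₁₃ F N θ.toStage13Params p).lf.alpha1 ((settingOfRecord₁₃ F N θ.toStage13Params p).flow.g 1)))) ∧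
        (∀ X : (Sect2.domSys (F.P p.K) θ.τ9.M 1).Dom,
          AnalyticOnNhd ℂ ((u s).R 1 X)
            ((sect2TowerOfRecord F N (FluctV N) p.K (settingOfRecord₁₃ F N θ.toStage13Params p) (θ.rzAt p s) s (u s)).space 1 X
              ((settingOfRecord₁₃ F N θ.toStage13Params p).lf.alpha0 ((settingOfRecord₁₃ F N θ.toStage13Params p).flow.g 1))
              ((settingOfRecord₁₃ F N θ.toStage13Params p).lf.alpha1 ((settingOfRecord₁₃ F N θ.toStage13Params p).flow.g 1)))) ∧
        (∀ (X : (Sect2.domSys (F.P p.K) θ.τ9.M 1).Dom) (a : SFluct (F.P p.K) (FluctV N)),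
          AnalyticOnNhd ℂ (fun φ => (u s).B 1 X φ a)
            ((sect2TowerOfRecord F N (FluctV N) p.K (settingOfRecord₁₃ F N θ.toStage13Params p) (θ.rzAt p s) s (u s)).spaceB 1 X)) ∧
        -- (iii″) the 𝐓-image identity of the first step IN THE CHART
        (slotsTOfRecord F N θ.ν θ.τ9 (EOfRecord₁₃ F N θ.toStage13Params) (wOfRecord₉ F N θ.toStage9Params) θ.ppSel p
            (gOfRecord₁₃ F N θ.toStage13Params p) 1 s = 0 ∨
          ∀ᵐ V' ∂fieldMeasure (F.P p.K) 1 (SU N),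
            chiSeqOfRecord F N θ.ν θ.τ9.M (gOfRecord₁₃ F N θ.toStage13Params p) p.K 1 s V' ≠ 0 →
              ∫ x, (J (V', x) : ℝ) * (wOfRecord₉ F N θ.toStage9Params p (gOfRecord₁₃ F N θ.toStage13Params p) 0 s (Ψ (V', x)) V' *
                  rhoZeroOfRecord F N p.K (gOfRecord₁₃ F N θ.toStage13Params p 0) (EOfRecord₁₃ F N θ.toStage13Params p) (Ψ (V', x))) ∂(κ V') =
                TkOfRecord F N (FluctV N) θ.ν θ.τ9.M (gOfRecord₁₃ F N θ.toStage13Params p) p.K (WtOfRecord₁₃H F N θ p s) 1 s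
                  (sect2Operand F N (FluctV N) p.K (settingOfRecord₁₃ F N θ.toStage13Params p) (θ.rzAt p s) s (u s) (E₁ s)
                    (UbgOfRecord₁₃CoP F N θ.toStage13Params p 1 s)) V') := by
  have hae := ae_forall_slotsTOfRecord₁₃H_one_eq_chart θ p hK hΨ hJ h𝒮 hchart hw hw𝒮
  unfold FirstStepIntegralIdentityAt
  refine exists_congr fun u => exists_congr fun E₁ => and_congr_right fun _ => forall_congr' fun s => forall_congr' fun _ => ?_
  refine and_congr_right fun _ => and_congr_right fun _ => and_congr_right fun _ => and_congr_right fun _ => ?_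
  rw [← slotsTOfRecord₁₃H_one_eq θ p s]
  refine or_congr_right (Filter.eventually_congr ?_)
  filter_upwards [hae] with V' hV'
  rw [← slotsTOfRecord₁₃H_one_apply θ p s V', hV' s]

end FirstStep

/-! ## §6  The hypothesis `hchart` is satisfiable by genuine data: along `Prod.fst` the second factor charts the joint law (identity chart, unit Jacobian) -/

section Inhabited

variable {α Y : Type*} [MeasurableSpace α] [MeasurableSpace Y]

/-- **`hchart` INHABITED (anti-vacuity, by shape)**: for a product reference `dU = μ ⊗ τ` on `β = α × Y` averaged by `avg = Prod.fst` against `dV = μ`, the trivial chart —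
fibre coordinates `X = Y`, constant fibre reference `κ = Kernel.const α τ`, `Ψ(V, y) = (V, y)`, `J ≡ 1`, window `univ` — satisfies FILE 1's hypothesis:
`((μ ⊗ₘ Kernel.const α τ).withDensity 1).map (z ↦ (z.1, z)) = (jointLaw (μ.prod τ) Prod.fst).restrict univ`.  So the socket's antecedent is satisfiable and its conclusions
are not vacuous-by-shape (the Lie–Haar chart of [III] pp. 267–270 is the non-trivial instance, owed by the chart seat). [cite: Balaban1987RG1, (0.4) p.253 (bookkeeping: the product case of the disintegration)] -/
theorem chart_fst_prod (μ : Measure α) [SFinite μ] (τ : Measure Y) [SFinite τ] :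
    ((μ ⊗ₘ Kernel.const α τ).withDensity (fun z => ((fun _ : α × Y => (1 : ℝ≥0)) z : ℝ≥0∞))).map (fun z => (z.1, (fun z : α × Y => z) z)) =
      (jointLaw (μ.prod τ) Prod.fst).restrict Set.univ := by
  rw [Measure.restrict_univ, Measure.compProd_const]
  have h1 : (μ.prod τ).withDensity (fun z => ((fun _ : α × Y => (1 : ℝ≥0)) z : ℝ≥0∞)) = μ.prod τ := by
    have e : (fun z => ((fun _ : α × Y => (1 : ℝ≥0)) z : ℝ≥0∞)) = 1 := by
      funext z
      simp only [ENNReal.coe_one, Pi.one_apply]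
    rw [e, withDensity_one]
  rw [h1]
  rfl

end Inhabited

/-! ## §7 (v1.1, APPEND-ONLY — §1–§6 byte-identical)  A6 AT THE RECORD: FILE 1's hypothesis `hchart` is inhabited by def-T's disintegration itself (fibre coordinates =
the fine field, `κ := condLaw`, `Ψ(V,U) := U`, `J := margDensity ∘ fst`, window `univ`, where `hw𝒮` is void) — so the antecedents of §4–§5 are satisfiable at `fieldMeasure` ∕
`avOfRecord`; the NON-trivial inhabitant (Bałaban's exponential chart ∘ axial gauge ∘ (47)) is the chart seat's. -/

section TautologicalChart

variable {α β : Type*} [MeasurableSpace α] [MeasurableSpace β] [StandardBorelSpace β] [Nonempty β]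
variable {ν : Measure β} [IsFiniteMeasure ν] {μ : Measure α} [SigmaFinite μ] {avg : β → α}

/-- **`hchart` INHABITED BY THE DISINTEGRATION ITSELF** (generic; `X := β`, `κ := condLaw ν avg`, `Ψ(V,U) := U`, `J := margDensity ν μ avg ∘ fst`, window `univ`): def-T's
`jointLaw_eq_withDensity_compProd` under `ν.map avg ≪ μ`. [cite: Balaban1987RG1, (0.4) p.253 (bookkeeping: the disintegration identity as a chart of itself)] -/
theorem chart_disintegration (havg : Measurable avg) (hac : ν.map avg ≪ μ) :
    ((μ ⊗ₘ condLaw ν avg).withDensity (fun z => (margDensity ν μ avg z.1 : ℝ≥0∞))).map (fun z : α × β => (z.1, z.2)) =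
      (jointLaw ν avg).restrict Set.univ := by
  have hid : (fun z : α × β => (z.1, z.2)) = id := funext fun _ => rfl
  rw [Measure.restrict_univ, ← jointLaw_eq_withDensity_compProd ν μ havg hac, hid, Measure.map_id]

end TautologicalChart

section TautologicalChartRecord

open Node00 hiding SU
open T4Continuum

variable {F : T4Family} {N : ℕ} [NeZero N]

/-- **`hchart` INHABITED AT THE RECORD** (A6 for §4–§5): for `k < K`, with `κ := avgKernel (avOfRecord …)`, `Ψ(V′,U) := U`, `J := avgDensity (avOfRecord …) ∘ fst`, window
`univ`, FILE 1's hypothesis holds at `(fieldMeasure k, fieldMeasure (k+1), avOfRecord F N K k)` — the antecedents of §4–§5 are satisfiable at the record (`hw𝒮` void).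
[cite: Balaban1988Convergent, (3.1) p.264 (bookkeeping); Balaban1987RG1, (0.4) p.253] -/
theorem chart_disintegration_record {K k : ℕ} (hk : k < K) :
    (((fieldMeasure (F.P K) (k + 1) (SU N)) ⊗ₘ avgKernel (avOfRecord F N K k).avg).withDensity
        (fun z => (avgDensity (avOfRecord F N K k).avg z.1 : ℝ≥0∞))).map
        (fun z : GaugeField (F.P K) (k + 1) (SU N) × GaugeField (F.P K) k (SU N) => (z.1, z.2)) =
      (jointLaw (fieldMeasure (F.P K) k (SU N)) (avOfRecord F N K k).avg).restrict Set.univ :=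
  chart_disintegration (avOfRecord_measurable F N K k) (avOfRecord_haarAC F N K k hk)

end TautologicalChartRecord

end Summit.QuantumFields.YangMills.Theorems.BalabanUVNodesN11TStepInFibreChart

end
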